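import Summits.QuantumFields.YangMills.Theorems.BalabanUVNodesN15PerCubeGreenAdjointCubesUNLoc
import Summits.QuantumFields.YangMills.Theorems.BalabanUVNodesN15PerCubeGreenAdjointRightEntries
import Summits.QuantumFields.YangMills.Theorems.BalabanUVNodesN15PerCubeGreenAdjointSmallness
import Summits.QuantumFields.YangMills.Theorems.BalabanUVNodesN15CovariantLandauFlatRowsAllKing
import HarnessLib

/-!
# N15 = NE2, road (c) — PROGRAMME (PC), towards (PC-A″) «the THIRD sup-norm entry `G′(U)∇*_U` of [B9] (3.42) in per-cube gauges», IV: ★★★ THE ADJOINT KNIT ON SITES — n15-c∕281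
# (the `U(N)` adjoint capstone: a right factor of per-cube covariant shape through ANY right inverse of `Δ_{R_U} + P`) INSTANTIATED on the site carrier of n15-c∕260 with the
# plateau-compressed cubes, the sandwiched right entries and the exact flat right locality of n15-c∕282a∕b, every cover ∕ cube ∕ partition ∕ smallness row DISCHARGED BY NAME;
# displayed: the gauges, `P`'s conjugation law, the local letters `r_V`, `r_D` (NEW: the quotients of `a^±`), `N_V`'s letters, the right factor's covariant shape — the right factor's coefficient rows ON THE CUT BOX ONLY (dag-n15-c g27, n15-c∕283′)

Cell `pub-ymgap`, seat `pub-ymgap-dag-n15-c` (generation g27; R134 (a), s1; HUMAN RULING D-0062).  `bears_on: R4∕N15 · K3⁸ SpineGivenEndpointR13SepCoPHV (stmt-QuantumFields-27366)`;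
filed `--kind proof --supports stmt-QuantumFields-27366 --as helper` — COUNT-NEUTRAL.  One theorem, 0 `def`, 0 `sorry`.  Imports BY NAME n15-c∕281′ (`uN_hasMaj_rightInverse_comp_localGauges_cov_loc`),
n15-c∕282a∕b (`hasMaj_cut∕cutF∕cutB_scCubeP`, `scCubeP_fgrad∕bgrad_sandwich`, `hasMaj_scT`, `hasMaj_mulVecLin_comp_fgrad∕bgrad`, `scCubeP_flat_rightLocality`, `scPsi_near_scChi`, …),
n15-c∕282c (`adjSmall`, `adjThetaA_le`), dag-n15-a Ξ-4 `flatRowsAll_king` (rows r1–r4 incl. the RIGHT entry `G′(1)∂ᵀ`), and through n15-c∕262's imports every site ∕ lattice lemma it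
used.  Nothing in the tree is modified.  GENERATED by the seat's `gen/buildA3b.py` (binder list parsed from n15-c∕281; site substitution and per-hypothesis proofs = n15-c∕262's generator
extended by the adjoint block).

THE THEOREM `uN_scAdj_rightInverse_loc_spec` (n15-c∕283 VERBATIM except that the rows `r_R, r_{∇R}, r_B` are asked ONLY where `χ_k ≠ 0` — through n15-c∕281′∕280′; SUPERSEDES 283).  For odd `L ≥ 7`, `a₀ > 0`, a colour index `ι`: there are `δ, R₀, θ₀ > 0`, `w₀` and `B₀, B₁, B₂ ≥ 0` such that on EVERY doubled torus of the
cover (`k ≥ 1`, `L^m ≥ w₀`), at King's mass, for EVERY trace-form `e`, unitary per-cube site gauges `u_k`, unitary site bond field `U`, summand `P` with the conjugation law `M_{W_k}PM_{W_kᵀ}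
= a·Q′ᵀQ′ ⊗ 1 − N_V k`, perturbation `N_V` (cut letter `R_N`, far letter `θ_F ≤ θ₀` from outside the bump to the cell), local letters `r_V` (species of the transformed bond variables
where `χ_k ≠ 0`) AND `r_D ≤ R₀` (their quotients along the bond direction), `r_V(1 + |J⊕J|) + R_N ≤ R₀`, and EVERY right factor `E` with scalar adjoint Leibniz rule through the
partition (`|dh| ≤ π∕L^m`) and per-cube covariant shape `M_{W_k}EM_{W_kᵀ} = M_{R_k}∇⁻_ν + M_{B_k}` (rows `r_R, r_{∇R}, r_B`):  EVERY right inverse `Y` of `Δ_{R_U} + P` satisfies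
`Y∘E ≤ (B₀ + B₁r_R + B₂(r_{∇R} + r_B))·e^{−(δ∕16)|y−y′|_T}`.  Constants: `δ, C` from Ξ-4; `σ = δ∕32` (the adjoint rate `ρ₃ − 2σ = δ∕16`); `β^Q = Ce^{δ}c_r + C` (the forward right
entry costs one site shift); `R₀ = 1∕(2β̄_πc_r² + 2A_θc_r + 1)`; `θ₀`, `w₀` from n15-c∕282c's budget.

HONEST FRAMING ∕ LIMITS.  Composition of LANDED theorems on MODEL carriers (the doubled-cube torus cover, one scale, compressed torus Green's functions as local propagators), the bond
field `U` LIVE only through displayed hypotheses; the SHAPE of the third entry of [B9] (3.42) with per-cube gauges at MODEL level, NOT the printed theorem; nothing of [B5]∕[B6]∕[B9]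
asserted ((3.42) p.397, (3.62)–(3.65) pp.402–403, (3.87)–(3.90) pp.409–410, (2.91)–(2.93) p.239, (2.133)–(2.136) p.247 = SHAPES ∕ MECHANISM).  NE2⁺ NOT PRINTED, NOT proved; N15 of
record untouched (DISCHARGED AS CONSUMED, p687738); K3⁸ OPEN; counts of record UNMOVED (typed 28∕28 · discharged 8∕27); one finite 𝕋⁴ at fixed ε per index — NOT infinite volume,
NOT OS on ℝ⁴, NOT a mass gap, NOT Clay.  Restate-immune (no Theses import).  `maxHeartbeats 1600000` ∕ `maxRecDepth 2048` for the one 120-argument application.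
-/

noncomputable section

open scoped BigOperators Matrix Matrix.Norms.Frobenius

namespace Summit.QuantumFields.YangMills.BalabanUVNodes.N15.Gluing

open Real
open Literature.MathematicalPhysics.QuantumFieldTheory.Balaban1983to89
open Literature.MathematicalPhysics.QuantumFieldTheory.Balaban1983to89.B5Prop11Plancherel (Tor fine unitVec)
open Literature.MathematicalPhysics.QuantumFieldTheory.Balaban1983to89.B11SectG (BlockNorm HasMaj RowSum hasMaj_zero)
open Literature.MathematicalPhysics.QuantumFieldTheory.Balaban1983to89.B6RandomWalk (Triangle254)
open Literature.MathematicalPhysics.QuantumFieldTheory.Balaban1983to89.B6Prop26Gluing (mulOp mulOp_apply ind ind_nonneg ind_le_one)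
open Literature.MathematicalPhysics.QuantumFieldTheory.Balaban1983to89.B6UnitTorusCarrier (unitTorusGeo triangle254_unitTorusGeo rowSum_unitTorusGeo unitTorusGeo_dist unitTorusGeo_dist_nonneg
  unitTorusGeo_dist_symm unitTorusGeo_dist_self)
open Literature.MathematicalPhysics.QuantumFieldTheory.Balaban1983to89.B5SiteBridgeP12 (MP)
open Literature.MathematicalPhysics.QuantumFieldTheory.King1986 (aK aK_pos aK_le)
open Literature.MathematicalPhysics.QuantumFieldTheory.King1986.Torus (blockOf tdistT tdistT_nonneg tdistT_symm)
open Literature.Barriers.QuantumFields (traceForm)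
open Summit.QuantumFields.YangMills.BalabanUVNodes.N15.BackgroundLayer (fgrad fgradAdj bgrad fgrad_apply fgradAdj_apply bgrad_apply stack projO bgPropV covLapM tCoefA tCoefC unstackM fgradMat)
open Summit.QuantumFields.YangMills.BalabanUVNodes.N15.VectorPiece (bshiftEquiv bshiftEquiv_apply tensorId tdistT_blockOf_sub_unitVec_le)
open Summit.QuantumFields.YangMills.BalabanUVNodes.N15.MatrixSpecies (mmulOp coordMat liftBlk liftEquiv liftEquiv_apply liftEquiv_symm_apply)
open Summit.QuantumFields.YangMills.BalabanUVNodes.N15.TwoGrid (paramsOf chiCube cubeBlocks chiCube_of_not_mem abs_chiCube_le_one)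
open Summit.QuantumFields.YangMills.BalabanUVNodes.N15.CurvedSpecies (gaugePair uN_hasMaj_rightInverse_comp_localGauges_cov_loc)
open Summit.QuantumFields.YangMills.BalabanUVNodes.N15.CovLandau (cgrad csavg cGreen bBack flatRowsAll_king)

variable {d : ℕ}

/-! ## The adjoint knit on sites: a right factor of per-cube covariant shape through any right inverse -/

section Knit

variable {L : ℕ} [NeZero L]

set_option maxHeartbeats 1600000 in
set_option maxRecDepth 2048 in
/-- ★★★ **THE ADJOINT KNIT ON SITES** (n15-c∕281 instantiated on n15-c∕260's site carrier with n15-c∕282a∕b's plateau-compressed cubes and right entries; every cover row discharged by name;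
n15-c∕282c's smallness): for EVERY right inverse `Y` of `Δ_{R_U} + P` and every right factor `E` of the displayed per-cube covariant shape, `Y∘E ≤ (B₀ + B₁r_R + B₂(r_{∇R} + r_B))·
e^{−(δ∕16)|y−y′|_T}`.  MODEL carriers; the SHAPE of the third entry of [B9] (3.42) with per-cube gauges, NOT the printed theorem.
[cite: Balaban1985BackgroundPropagators, Thm 3.1 (3.42) p.397 (entry `G′(U)∇*_U`: shape), Thm 3.7 (3.90) p.409, Cor. 3.6 p.408, (3.34)–(3.35) p.396, (3.62)–(3.65) pp.402–403 (mechanism); Balaban1984PropagatorsII, (2.91)–(2.93) p.239, (2.133)–(2.136) p.247 (transposed)] -/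
theorem uN_scAdj_rightInverse_loc_spec (hL : Odd L ∧ 1 < L) (hL7 : 7 ≤ L) {a₀ : ℝ} (ha₀ : 0 < a₀) (ι : Type) [Fintype ι] [DecidableEq ι] :
    ∃ δ w₀ R₀ θ₀ B₀ B₁ B₂ : ℝ, 0 < δ ∧ 0 < R₀ ∧ 0 < θ₀ ∧ 0 ≤ B₀ ∧ 0 ≤ B₁ ∧ 0 ≤ B₂ ∧
      ∀ (mv kk : ℕ), 1 ≤ kk → w₀ ≤ ((L ^ mv : ℕ) : ℝ) →
      ∀ {mm : Type} [Fintype mm] [DecidableEq mm] (e : Matrix mm mm ℂ ≃L[ℝ] (ι → ℝ)), (∀ A B : Matrix mm mm ℂ, traceForm A B = e A ⬝ᵥ e B) →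
      ∀ (u : (Fin (d + 1) → ZMod (2 * L)) → ScX d L mv kk hL → Matrix mm mm ℂ), (∀ k x, (u k x)ᴴ * u k x = 1) →
      ∀ (U : Fin (d + 1) → ScX d L mv kk hL → Matrix mm mm ℂ) (P : (ScX d L mv kk hL × ι → ℝ) →ₗ[ℝ] (ScX d L mv kk hL × ι → ℝ))
        (NV : (Fin (d + 1) → ZMod (2 * L)) → (ScX d L mv kk hL × ι → ℝ) →ₗ[ℝ] (ScX d L mv kk hL × ι → ℝ)) (rV rD RN θF : ℝ),
        0 ≤ rV → 0 ≤ rD → 0 ≤ RN → 0 ≤ θF → rV * (1 + Fintype.card (Fin (d + 1) ⊕ Fin (d + 1))) + RN ≤ R₀ → rD ≤ R₀ → θF ≤ θ₀ →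
        (∀ k, mmulOp (fun x => coordMat e (ContinuousLinearMap.mulLeftRight ℝ (Matrix mm mm ℂ) (u k x) (u k x)ᴴ)) ∘ₗ P ∘ₗ mmulOp (fun x => (coordMat e (ContinuousLinearMap.mulLeftRight ℝ (Matrix mm mm ℂ) (u k x) (u k x)ᴴ))ᵀ) = (scQQ d L mv kk hL (aK a₀ (L : ℝ) kk * (((L ^ kk : ℕ) : ℝ)) ^ (d + 1)) ι) - NV k) →
        (∀ k x, scChi d L mv kk hL k x ≠ 0 → ∀ i, ∑ j, |(tCoefC ((((L ^ kk : ℕ) : ℝ))⁻¹) (gaugePair (scShift d L mv kk hL) fun μ x => coordMat e (ContinuousLinearMap.mulLeftRight ℝ (Matrix mm mm ℂ) (u k x * U μ x * (u k (scShift d L mv kk hL μ x))ᴴ) (u k x * U μ x * (u k (scShift d L mv kk hL μ x))ᴴ)ᴴ))) x i j| ≤ rV) →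
        (∀ k j' x, scChi d L mv kk hL k x ≠ 0 → ∀ i, ∑ j, |(tCoefA ((((L ^ kk : ℕ) : ℝ))⁻¹) (gaugePair (scShift d L mv kk hL) fun μ x => coordMat e (ContinuousLinearMap.mulLeftRight ℝ (Matrix mm mm ℂ) (u k x * U μ x * (u k (scShift d L mv kk hL μ x))ᴴ) (u k x * U μ x * (u k (scShift d L mv kk hL μ x))ᴴ)ᴴ))) j' x i j| ≤ rV) →
        (∀ k μ x, scChi d L mv kk hL k x ≠ 0 → ∀ i, ∑ j, |fgradMat (((L ^ kk : ℕ) : ℝ)) (scShift d L mv kk hL μ) ((tCoefA ((((L ^ kk : ℕ) : ℝ))⁻¹) (gaugePair (scShift d L mv kk hL) fun μ x => coordMat e (ContinuousLinearMap.mulLeftRight ℝ (Matrix mm mm ℂ) (u k x * U μ x * (u k (scShift d L mv kk hL μ x))ᴴ) (u k x * U μ x * (u k (scShift d L mv kk hL μ x))ᴴ)ᴴ))) (Sum.inl μ)) x i j| ≤ rD) →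
        (∀ k μ x, scChi d L mv kk hL k x ≠ 0 → ∀ i, ∑ j, |fgradMat (((L ^ kk : ℕ) : ℝ)) (scShift d L mv kk hL μ) ((tCoefA ((((L ^ kk : ℕ) : ℝ))⁻¹) (gaugePair (scShift d L mv kk hL) fun μ x => coordMat e (ContinuousLinearMap.mulLeftRight ℝ (Matrix mm mm ℂ) (u k x * U μ x * (u k (scShift d L mv kk hL μ x))ᴴ) (u k x * U μ x * (u k (scShift d L mv kk hL μ x))ᴴ)ᴴ))) (Sum.inr μ)) x i j| ≤ rD) →
        (∀ k, HasMaj (ScNorm d L mv kk hL ι) (ScNorm d L mv kk hL ι) (mulOp (fun p : ScX d L mv kk hL × ι => scPsi d L mv kk hL k p.1) ∘ₗ NV k ∘ₗ mulOp (fun p : ScX d L mv kk hL × ι => scChi d L mv kk hL k p.1)) (fun y y' => RN * Real.exp (-(δ * (unitTorusGeo L kk (cvM d L mv kk hL)).dist y y')))) →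
        (∀ k, HasMaj (ScNorm d L mv kk hL ι) (ScNorm d L mv kk hL ι) (mulOp (fun p : ScX d L mv kk hL × ι => scH d L mv kk hL k p.1) ∘ₗ NV k ∘ₗ (LinearMap.id - mulOp (fun p : ScX d L mv kk hL × ι => scBump d L mv kk hL k p.1))) (fun y y' => θF * Real.exp (-(δ * (unitTorusGeo L kk (cvM d L mv kk hL)).dist y y')))) →
      ∀ (ν : Fin (d + 1)) (E : (ScX d L mv kk hL × ι → ℝ) →ₗ[ℝ] (ScX d L mv kk hL × ι → ℝ)) (RE BE : (Fin (d + 1) → ZMod (2 * L)) → ScX d L mv kk hL → Matrix ι ι ℝ)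
        (dh : (Fin (d + 1) → ZMod (2 * L)) → ScX d L mv kk hL → ℝ) (rR rR' rB : ℝ), 0 ≤ rR → 0 ≤ rR' → 0 ≤ rB →
        (∀ k, mulOp (fun p : ScX d L mv kk hL × ι => scH d L mv kk hL k p.1) ∘ₗ E = E ∘ₗ mulOp (fun p : ScX d L mv kk hL × ι => scH d L mv kk hL k (scShift d L mv kk hL ν p.1)) + mulOp (fun p : ScX d L mv kk hL × ι => dh k p.1)) →
        (∀ k x, |dh k x| ≤ (π / ((L ^ mv : ℕ) : ℝ))) →
        (∀ k, mmulOp (fun x => coordMat e (ContinuousLinearMap.mulLeftRight ℝ (Matrix mm mm ℂ) (u k x) (u k x)ᴴ)) ∘ₗ E ∘ₗ mmulOp (fun x => (coordMat e (ContinuousLinearMap.mulLeftRight ℝ (Matrix mm mm ℂ) (u k x) (u k x)ᴴ))ᵀ) = mmulOp (RE k) ∘ₗ bgrad (((L ^ kk : ℕ) : ℝ)) (liftEquiv (scShift d L mv kk hL ν) ι) + mmulOp (BE k)) →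
        (∀ k x, scChi d L mv kk hL k x ≠ 0 → ∀ i, ∑ j, |(RE k ∘ ⇑(scShift d L mv kk hL ν)) x i j| ≤ rR) →
        (∀ k x, scChi d L mv kk hL k x ≠ 0 → ∀ i, ∑ j, |(fgradMat (((L ^ kk : ℕ) : ℝ)) (scShift d L mv kk hL ν) (RE k)) x i j| ≤ rR') →
        (∀ k x, scChi d L mv kk hL k x ≠ 0 → ∀ i, ∑ j, |BE k x i j| ≤ rB) →
      ∀ (Yop : (ScX d L mv kk hL × ι → ℝ) →ₗ[ℝ] (ScX d L mv kk hL × ι → ℝ)), (covLapM (scShift d L mv kk hL) ((((L ^ kk : ℕ) : ℝ))⁻¹) (gaugePair (scShift d L mv kk hL) (fun μ x => coordMat e (ContinuousLinearMap.mulLeftRight ℝ (Matrix mm mm ℂ) (U μ x) (U μ x)ᴴ))) + P) ∘ₗ Yop = LinearMap.id →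
        HasMaj (ScNorm d L mv kk hL ι) (ScNorm d L mv kk hL ι) (Yop ∘ₗ E)
          (fun y y' => (B₀ + B₁ * rR + B₂ * (rR' + rB)) * Real.exp (-(δ / 16 * (unitTorusGeo L kk (cvM d L mv kk hL)).dist y y'))) := by
  obtain ⟨hL2, hL3⟩ : 2 ≤ L ∧ 3 ≤ L := ⟨by omega, by omega⟩
  have hL1r : (1 : ℝ) < (L : ℝ) := by exact_mod_cast hL.2
  obtain ⟨C, δm, hC, hδm0, H⟩ := flatRowsAll_king (d := d) L hL.1 hL2 ha₀ (γ := (1 / 4 : ℝ)) (by norm_num) (by norm_num)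
  set cr : ℝ := B4Sect5Proof.latticeConst (d + 1) (δm / 32) with hcr_def
  have hcr0 : 0 ≤ cr := B4Sect5Proof.latticeConst_nonneg (d + 1) (by positivity)
  set δT : ℝ := δm - δm / 32 with hδTdef
  set β : ℝ := C with hβdef
  set β₁ : ℝ := C with hβ₁def
  set βQ : ℝ := C * Real.exp δm * cr + C with hβQdef
  have hβQ0 : 0 ≤ βQ := by positivity
  set Nov : ℝ := (((2 * L) ^ (d + 1) : ℕ) : ℝ) with hNovdef
  set cι2 : ℝ := (Fintype.card ι : ℝ) ^ 2 with hcι2def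
  set cJ : ℝ := (Fintype.card (Fin (d + 1)) : ℝ) with hcJdef
  set P₂ : ℝ := 2 * (β + (β₁ + π * β)) with hP₂def
  set X₂ : ℝ := 2 * βQ * cr with hX₂def
  set Aθ : ℝ := β + cJ * (2 * (βQ + 2 * β)) + β * cr with hAθdef
  set R : ℝ := 1 / (2 * ((β + (β₁ + π * β)) * cr * cr) + 2 * (Aθ * cr) + 1) with hRdef
  set θ₀ : ℝ := 1 / (4 * (Nov * cr * (cι2 * (P₂ * cr))) + 1) with hθ₀def
  set AW : ℝ := cJ * (3 * P₂ * (32 * π ^ 2) + 2 * X₂ * π) + P₂ * (2 * (π * ((d : ℝ) + 1)) * a₀) * cr +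
      cJ * (2 * R * (π * P₂ + π * X₂)) + P₂ * ((π * ((d : ℝ) + 1) * (Real.exp 1 * (δm / 2))⁻¹ + 2 * (π * ((d : ℝ) + 1))) * R) * cr with hAWdef
  set w₀ : ℝ := 4 * (Nov * cr * (cι2 * AW)) + 4 with hw₀def
  set B₀ : ℝ := 2 * (Nov * (cι2 * P₂ * π) * cr) with hB₀def
  set B₁ : ℝ := 2 * (Nov * (cι2 * X₂) * cr) with hB₁def
  set B₂ : ℝ := 2 * (Nov * (cι2 * P₂) * cr) with hB₂def
  have hβ0 : 0 ≤ β := hC.le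
  have hβ₁0 : 0 ≤ β₁ := hC.le
  have hNov0 : 0 ≤ Nov := by positivity
  have hR0 : 0 < R := by positivity
  have hθ₀0 : 0 < θ₀ := by positivity
  refine ⟨δm, w₀, R, θ₀, B₀, B₁, B₂, hδm0, hR0, hθ₀0, by positivity, by positivity, by positivity, fun mv kk hk hw₀ => ?_⟩
  intro mm _ _ e he u hu U P NV rV rD RN θF hrV hrD hRN hθF0 hRle hrDle hθle hP hCloc hAloc hDAf hDAb hNVcut hfarN ν E RE BE dh rR rR' rB hrR hrR' hrB hleib hdh hEcov hRE hRE' hBE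
    Yop hY
  -- the data of the cover at `(m, k)` (as in n15-c∕262)
  have hn : 1 ≤ L ^ kk := Nat.one_le_pow _ _ (by omega)
  have hWAW : 4 * (Nov * cr * (cι2 * AW)) ≤ ((L ^ mv : ℕ) : ℝ) := by linarith only [hw₀]
  have hW4R : (4 : ℝ) ≤ ((L ^ mv : ℕ) : ℝ) := by
    have : 0 ≤ 4 * (Nov * cr * (cι2 * AW)) := by positivity
    linarith only [this, hw₀]
  have hW2R : (2 : ℝ) ≤ ((L ^ mv : ℕ) : ℝ) := by linarith only [hW4R]
  have hW2 : 2 ≤ L ^ mv := by exact_mod_cast hW2R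
  have hW3 : 3 ≤ L ^ mv := by
    -- `L ≥ 7` is odd-free here: `L^m = 2` is impossible for `L ≥ 7` unless `m = 0`, when `L^0 = 1 < 2`
    rcases Nat.eq_zero_or_pos mv with h0 | hpos
    · subst h0; simp at hW2
    · calc 3 ≤ 7 := by norm_num
        _ ≤ L := hL7
        _ = L ^ 1 := (pow_one L).symm
        _ ≤ L ^ mv := Nat.pow_le_pow_right (by omega) hpos
  have hw : 0 < L ^ mv := by omega
  have hW1 : (1 : ℝ) ≤ ((L ^ mv : ℕ) : ℝ) := by linarith only [hW2R]
  have hWpos : (0 : ℝ) < ((L ^ mv : ℕ) : ℝ) := by linarith only [hW2R]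
  have hM : ∀ ν, cvM d L mv kk hL ν = 2 * L * L ^ mv := MP_succ_eq L mv kk hL
  have hMc : ∀ ν, cvM d L mv kk hL ν = 2 * L ^ (mv + 1) := fun ν => rfl
  have hlo : (2 : ℝ) * ((L ^ mv : ℕ) : ℝ) ≤ ((2 * L ^ mv : ℕ) : ℝ) := by push_cast; exact le_rfl
  have hhi : ((2 * L ^ mv : ℕ) : ℝ) + ((L ^ mv : ℕ) : ℝ) + (2 + 1) * ((L ^ mv : ℕ) : ℝ) + 1 ≤ ((6 * L ^ mv + 1 : ℕ) : ℝ) := by push_cast; linarith only []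
  have hS6 : 6 * L ^ mv + 1 ≤ 2 * L * L ^ mv := by
    have h7 : 7 * L ^ mv ≤ L * L ^ mv := Nat.mul_le_mul_right _ hL7
    have e : 2 * L * L ^ mv = 2 * (L * L ^ mv) := by ring
    rw [e]; omega
  have hm₁ : 2 * L ^ mv ≤ coverMargin L mv := two_mul_le_coverMargin hL7 mv
  have hfitI : coverMargin L mv - 2 * L ^ mv + (6 * L ^ mv + 1) ≤ L * L ^ mv := coverMargin_inner_fit hL7 hW2
  have hm₂ : 2 * L ^ mv + 1 ≤ coverMargin L mv := (coverMargin_cut_margin hL7 hW3).1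
  have hfit₂ : coverMargin L mv - 2 * L ^ mv + (6 * L ^ mv + 1) + 1 ≤ L * L ^ mv := (coverMargin_cut_margin hL7 hW3).2
  have hfit0 := coverMargin_fit hL3 mv
  have hfit : coverMargin L mv + 2 * L ^ mv + 1 ≤ L * L ^ mv := by omega
  have hS0 : L * L ^ mv ≤ 2 * L * L ^ mv := by rw [mul_assoc]; omega
  have hR2 : 1 + |(((L ^ kk : ℕ) : ℝ) * ((L ^ mv : ℕ) : ℝ))⁻¹| ≤ (2 : ℝ) := one_add_inv_le_of_two_le 2 hw le_rfl
  obtain ⟨hK0, hK2⟩ : 0 < 2 * L ∧ 2 ≤ 2 * L := ⟨by omega, by omega⟩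
  set η : ℝ := (((L ^ kk : ℕ) : ℝ))⁻¹ with hη
  set W : ℝ := ((L ^ mv : ℕ) : ℝ) with hWdef
  have hηinv : η⁻¹ = ((L ^ kk : ℕ) : ℝ) := by rw [hη, inv_inv]
  have hnr : (0 : ℝ) < ((L ^ kk : ℕ) : ℝ) := by exact_mod_cast hn
  have hη1 : (1 : ℝ) ≤ η⁻¹ := by rw [hηinv]; exact_mod_cast hn
  have hrowS : RowSum (unitTorusGeo L kk (cvM d L mv kk hL)) (δm / 32) cr := by rw [hcr_def]; exact rowSum_unitTorusGeo L kk _ (by positivity)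
  -- the site coordinates' step and the partition letters
  have hξS := scXi_shift_lift ι hM hw (d := d) (L := L) (mv := mv) (kk := kk) (hL := hL)
  have hξ0 : ∀ μ ν (x : ScX d L mv kk hL), ∃ z : ℤ, scXi d L mv kk hL ν (scShift d L mv kk hL μ x) =
      scXi d L mv kk hL ν x + (if ν = μ then ((((L ^ kk : ℕ) : ℝ)) * ((L ^ mv : ℕ) : ℝ))⁻¹ else 0) + (z : ℝ) * ((2 * L : ℕ) : ℝ) :=
    fun μ ν x => coverXi_shift (n := L ^ kk) (q := L) hM hw μ ν (x, 0)
  have hs0 : (0 : ℝ) ≤ ((((L ^ kk : ℕ) : ℝ)) * ((L ^ mv : ℕ) : ℝ))⁻¹ := by positivity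
  have hs1 : ((((L ^ kk : ℕ) : ℝ)) * ((L ^ mv : ℕ) : ℝ))⁻¹ ≤ 1 := inv_le_one_of_one_le₀ (one_le_mul_of_one_le_of_one_le (by exact_mod_cast hn) hW1)
  have hsW : |((L ^ kk : ℕ) : ℝ)| * (π * |((((L ^ kk : ℕ) : ℝ)) * ((L ^ mv : ℕ) : ℝ))⁻¹|) = π / W := by
    rw [abs_of_pos hnr, abs_of_nonneg hs0, mul_inv, hWdef]; field_simp
  have hsW2 : ((L ^ kk : ℕ) : ℝ) ^ 2 * (32 * π ^ 2 * (((((L ^ kk : ℕ) : ℝ)) * ((L ^ mv : ℕ) : ℝ))⁻¹) ^ 2) = 32 * π ^ 2 / W ^ 2 := by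
    rw [mul_inv, hWdef]; field_simp
  -- King's window and the flat rows at the mass `a_K(a₀, L, k)·n^{d+1}`
  have haK : 0 < aK a₀ (L : ℝ) kk := aK_pos ha₀ hL1r hk
  have haKle : aK a₀ (L : ℝ) kk ≤ a₀ := aK_le ha₀ hL1r hk
  have ha' : 0 < aK a₀ (L : ℝ) kk * (((L ^ kk : ℕ) : ℝ)) ^ (d + 1) := by positivity
  have hcNle : |aK a₀ (L : ℝ) kk * (((L ^ kk : ℕ) : ℝ)) ^ (d + 1)| * ((((L ^ kk : ℕ) : ℝ)) ^ (d + 1))⁻¹ * (2 * (π * (d + 1) / (L ^ mv : ℕ))) ≤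
      (π * (d + 1) / W * 0 + 2 * (π * (d + 1) / W)) * a₀ := by
    rw [abs_of_pos ha', mul_assoc (aK a₀ (L : ℝ) kk), mul_inv_cancel₀ (by positivity), mul_one, mul_zero, zero_add, hWdef, mul_comm]
    exact mul_le_mul_of_nonneg_left haKle (by positivity)
  obtain ⟨hG0, hGF, hGA, hGB, -⟩ := H kk hk 1 le_rfl (mv + 1) (cvM d L mv kk hL) hMc ι
  -- the flat right entries on sites (n15-c∕282b), weakened to the letter `βQ` and the rate `δT = δm − σ`
  have rateT : ∀ (T : Set (Tor (cvM d L mv kk hL))) {c : ℝ}, 0 ≤ c → ∀ y y' : Tor (cvM d L mv kk hL),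
      ind (g := unitTorusGeo L kk (cvM d L mv kk hL)) T y * ind (g := unitTorusGeo L kk (cvM d L mv kk hL)) T y' * (c * Real.exp (-(δm * (unitTorusGeo L kk (cvM d L mv kk hL)).dist y y'))) ≤
        ind (g := unitTorusGeo L kk (cvM d L mv kk hL)) T y * ind (g := unitTorusGeo L kk (cvM d L mv kk hL)) T y' * (c * Real.exp (-(δT * (unitTorusGeo L kk (cvM d L mv kk hL)).dist y y'))) :=
    fun T c hc y y' => mul_le_mul_of_nonneg_left (exp_rate_mono (unitTorusGeo_dist_nonneg L kk _) hc (by rw [hδTdef]; linarith only [hδm0]) y y')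
      (mul_nonneg (ind_nonneg _ _) (ind_nonneg _ _))
  have hGAf : ∀ μ, HasMaj (ScNorm d L mv kk hL ι) (ScNorm d L mv kk hL ι) ((Matrix.mulVecLin (cGreen (cvM d L mv kk hL) (L ^ kk) (fun (_ : Fin (d + 1)) (_ : ScX d L mv kk hL) => (1 : Matrix ι ι ℝ)) (aK a₀ (L : ℝ) kk * (((L ^ kk : ℕ) : ℝ)) ^ (d + 1)))) ∘ₗ fgrad (((L ^ kk : ℕ) : ℝ)) (liftEquiv (scShift d L mv kk hL μ) ι))
      (fun y y' => βQ * Real.exp (-(δT * (unitTorusGeo L kk (cvM d L mv kk hL)).dist y y'))) := fun μ =>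
    (hasMaj_mulVecLin_comp_fgrad ι hC.le (by linarith only [hδm0] : δm / 32 ≤ δm) (by positivity) hrowS hGA μ).mono fun y y' => by
      rw [hδTdef]; exact mul_le_mul_of_nonneg_right (by rw [hβQdef]; exact le_add_of_nonneg_right hC.le) (Real.exp_nonneg _)
  have hGAb : ∀ μ, HasMaj (ScNorm d L mv kk hL ι) (ScNorm d L mv kk hL ι) ((Matrix.mulVecLin (cGreen (cvM d L mv kk hL) (L ^ kk) (fun (_ : Fin (d + 1)) (_ : ScX d L mv kk hL) => (1 : Matrix ι ι ℝ)) (aK a₀ (L : ℝ) kk * (((L ^ kk : ℕ) : ℝ)) ^ (d + 1)))) ∘ₗ bgrad (((L ^ kk : ℕ) : ℝ)) (liftEquiv (scShift d L mv kk hL μ) ι))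
      (fun y y' => βQ * Real.exp (-(δT * (unitTorusGeo L kk (cvM d L mv kk hL)).dist y y'))) := fun μ =>
    (hasMaj_mulVecLin_comp_bgrad ι hC.le hGA μ).mono fun y y' =>
      mul_le_mul (by rw [hβQdef]; exact le_add_of_nonneg_left (by positivity))
        (Real.exp_le_exp.mpr (by rw [hδTdef, unitTorusGeo_dist]; nlinarith only [hδm0, tdistT_nonneg (cvM d L mv kk hL) y y'])) (Real.exp_nonneg _) hβQ0
  -- the windows of the cut box about the partition cell, radius 2
  have hwin2 : ∀ (μ : Fin (d + 1)) (k : Fin (d + 1) → ZMod (2 * L)) (p : ScX d L mv kk hL × ι),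
      (∃ p₀ : ScX d L mv kk hL × ι, (p₀ = p ∨ p₀ = (fun μ => liftEquiv (scShift d L mv kk hL μ) ι) μ p ∨ p₀ = ((fun μ => liftEquiv (scShift d L mv kk hL μ) ι) μ).symm p) ∧
        ∀ ν, |cenRep (2 * L) ((fun ν (p : ScX d L mv kk hL × ι) => scXi d L mv kk hL ν p.1) ν p₀ - ((k ν).val : ℝ))| < 2 + 1) →
      (fun p : ScX d L mv kk hL × ι => scChi d L mv kk hL k p.1) p = 1 :=
    fun μ k p hp => scChi_lift_eq_one_of_near_bbox 2 ι hM hw hlo hhi hS6 μ k p hp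
  have hwin : ∀ (μ : Fin (d + 1)) (k : Fin (d + 1) → ZMod (2 * L)) (p : ScX d L mv kk hL × ι),
      (∃ p₀ : ScX d L mv kk hL × ι, (p₀ = p ∨ p₀ = (fun μ => liftEquiv (scShift d L mv kk hL μ) ι) μ p ∨ p₀ = ((fun μ => liftEquiv (scShift d L mv kk hL μ) ι) μ).symm p) ∧
        ∀ ν, |cenRep (2 * L) ((fun ν (p : ScX d L mv kk hL × ι) => scXi d L mv kk hL ν p.1) ν p₀ - ((k ν).val : ℝ))| < 1) →
      (fun p : ScX d L mv kk hL × ι => scChi d L mv kk hL k p.1) p = 1 :=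
    fun μ k => hcubeWindow_of_bumpWindow (2 * L) (fun ν (p : ScX d L mv kk hL × ι) => scXi d L mv kk hL ν p.1) 2
      (fun μ => liftEquiv (scShift d L mv kk hL μ) ι) μ (by norm_num) (hwin2 μ k)
  have hhχ : ∀ (k : Fin (d + 1) → ZMod (2 * L)) (x : ScX d L mv kk hL), scH d L mv kk hL k x ≠ 0 → scChi d L mv kk hL k x ≠ 0 := fun k x hx => by
    have h := chiCube_box_eq_one_of_coverH_ne_zero (n := L ^ kk) hM hw hS6 0 k (x := (x, (0 : Fin (d + 1)))) (Or.inl rfl) hx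
    rw [show scChi d L mv kk hL k x = chiCube (cvM d L mv kk hL) (L ^ kk) (coverCorner (cvM d L mv kk hL) (L ^ mv) L (2 * L ^ mv) k) (6 * L ^ mv + 1) (x, 0) from rfl, h]
    exact one_ne_zero
  -- the letters `≤ R`, the three smallness facts (n15-c∕282c)
  have hJ0 : (0 : ℝ) ≤ Fintype.card (Fin (d + 1) ⊕ Fin (d + 1)) := by positivity
  have hrVR : rV ≤ R := by nlinarith only [hRle, hRN, hrV, hJ0]
  have hRNR : RN ≤ R := by nlinarith only [hRle, hRN, hrV, hJ0]
  have hRden : 1 ≤ 2 * ((β + (β₁ + π * β)) * cr * cr) + 2 * (Aθ * cr) + 1 := by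
    have : 0 ≤ 2 * ((β + (β₁ + π * β)) * cr * cr) + 2 * (Aθ * cr) := by positivity
    linarith only [this]
  have hR1 : R ≤ 1 := by rw [hRdef, div_le_one (by positivity)]; exact hRden
  have hq₀ : (β + (β₁ + π / W * β)) * (R * cr) * cr ≤ 1 / 2 := by
    have hπw : π / W ≤ π := div_le_self pi_pos.le hW1
    have h1 : (β + (β₁ + π / W * β)) * (R * cr) * cr ≤ (β + (β₁ + π * β)) * (R * cr) * cr := by
      have := mul_le_mul_of_nonneg_right hπw hβ0
      exact mul_le_mul_of_nonneg_right (mul_le_mul_of_nonneg_right (by linarith only [this]) (by positivity)) hcr0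
    have h2 : (β + (β₁ + π * β)) * (R * cr) * cr = ((β + (β₁ + π * β)) * cr * cr) / (2 * ((β + (β₁ + π * β)) * cr * cr) + 2 * (Aθ * cr) + 1) := by
      rw [hRdef]; ring
    have h3 : ((β + (β₁ + π * β)) * cr * cr) / (2 * ((β + (β₁ + π * β)) * cr * cr) + 2 * (Aθ * cr) + 1) ≤ 1 / 2 := by
      rw [div_le_iff₀ (by positivity)]
      have : 0 ≤ (β + (β₁ + π * β)) * cr * cr := by positivity
      have : 0 ≤ Aθ * cr := by positivity
      linarith
    linarith only [h1, h2, h3]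
  have hθA : (β * rV + Fintype.card (Fin (d + 1)) * (2 * (βQ * rV + β * (rD + (π / W) * rV))) + β * RN * cr) * cr ≤ 1 / 2 := by
    have h1 := adjThetaA_le (cJ := (Fintype.card (Fin (d + 1)) : ℝ)) hβ0 hβQ0 (by positivity) hcr0 (div_le_one_of_le₀ (by linarith only [Real.pi_le_four, hW4R] : π ≤ W) hWpos.le) hrV hrVR
      (hrDle.trans le_rfl) hRNR
    have h2 : (β + (Fintype.card (Fin (d + 1)) : ℝ) * (2 * (βQ + 2 * β)) + β * cr) * R * cr ≤ 1 / 2 := by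
      rw [← hcJdef, ← hAθdef]
      have e : Aθ * R * cr = (Aθ * cr) / (2 * ((β + (β₁ + π * β)) * cr * cr) + 2 * (Aθ * cr) + 1) := by rw [hRdef]; ring
      rw [e, div_le_iff₀ (by positivity)]
      have : 0 ≤ (β + (β₁ + π * β)) * cr * cr := by positivity
      have : 0 ≤ Aθ * cr := by positivity
      linarith
    calc _ ≤ (β + (Fintype.card (Fin (d + 1)) : ℝ) * (2 * (βQ + 2 * β)) + β * cr) * R * cr := mul_le_mul_of_nonneg_right h1 hcr0
      _ ≤ 1 / 2 := h2
  have hsA : (β * rV + Fintype.card (Fin (d + 1)) * (2 * (βQ * rV + β * (rD + (π / W) * rV))) + β * RN * cr) * cr < 1 := hθA.trans_lt (by norm_num)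
  have hθbud : Nov * cr * (cι2 * ((2 * (β + (β₁ + π * β))) * θF * cr)) ≤ 1 / 4 := by
    rw [← hP₂def]
    have hX : 0 ≤ Nov * cr * (cι2 * (P₂ * cr)) := by positivity
    have e1 : Nov * cr * (cι2 * (P₂ * θF * cr)) = θF * (Nov * cr * (cι2 * (P₂ * cr))) := by ring
    have h2 : θF * (Nov * cr * (cι2 * (P₂ * cr))) ≤ θ₀ * (Nov * cr * (cι2 * (P₂ * cr))) := mul_le_mul_of_nonneg_right hθle hX
    rw [e1]
    refine h2.trans ?_
    rw [hθ₀def, div_mul_eq_mul_div, one_mul, div_le_iff₀ (by positivity)]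
    linarith only [hX]
  have hsmall := adjSmall (Nov := Nov) (cr := cr) (cι2 := cι2) (cJ := (Fintype.card (Fin (d + 1)) : ℝ)) (β := β) (β₁ := β₁) (βQ := βQ) (w := W) (R := R) (θF := θF)
    (θA := β * rV + Fintype.card (Fin (d + 1)) * (2 * (βQ * rV + β * (rD + (π / W) * rV))) + β * RN * cr) (rV := rV) (RN := RN) (rR := rR) (rR' := rR') (rB := rB)
    (ε := δm / 2) (cN₀ := a₀) (D := (d : ℝ) + 1)
    hNov0 hcr0 (by positivity) (by positivity) hβ0 hC.le hβQ0 hW1 hR0.le hθF0 (by positivity) ha₀.le (by positivity) hRN hrVR hRNR hrR hrR' hrB hq₀ hθA hθbud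
    (by rw [← hcJdef, ← hP₂def, ← hX₂def, ← hAWdef]; exact hWAW)
  -- 281's hypotheses at the cover
  have hβ₁ : 0 ≤ β₁ := hC.le
  have hSχ : ∀ k x, scChi d L mv kk hL k x ≠ 0 → scBlk d L mv kk hL x ∈ cvSk d L mv kk hL k := fun k x hx => Finset.mem_coe.mpr (blockOf_mem_cubeBlocks_of_inner_ne_zero hM hm₁ hfitI hS0 hx)
  have hSψ : ∀ k x, scPsi d L mv kk hL k x ≠ 0 → scBlk d L mv kk hL x ∈ cvSk d L mv kk hL k := fun k x hx => Finset.mem_coe.mpr (by by_contra h; exact hx (chiCube_of_not_mem h))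
  have hSψ₂ : ∀ k x, scPsi d L mv kk hL k x ≠ 0 → scBlk d L mv kk hL x ∈ cvSk d L mv kk hL k := fun k x hx => Finset.mem_coe.mpr (by by_contra h; exact hx (chiCube_of_not_mem h))
  have hdχt : ∀ k μ p, |fgrad η⁻¹ (liftEquiv (scShift d L mv kk hL μ) ι) (fun p : ScX d L mv kk hL × ι => scBump d L mv kk hL k p.1) p| ≤ (π / W) :=
    by rw [hηinv]; exact fun k μ p => (abs_fgrad_bcube_le (2 * L) (fun ν (p : ScX d L mv kk hL × ι) => scXi d L mv kk hL ν p.1) 2 (fun μ => liftEquiv (scShift d L mv kk hL μ) ι) hK0 hξS _ k μ p).trans hsW.le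
  have hdχtb : ∀ k μ p, |bgrad η⁻¹ (liftEquiv (scShift d L mv kk hL μ) ι) (fun p : ScX d L mv kk hL × ι => scBump d L mv kk hL k p.1) p| ≤ (π / W) :=
    by rw [hηinv]; exact fun k μ p => (abs_bgrad_bcube_le (2 * L) (fun ν (p : ScX d L mv kk hL × ι) => scXi d L mv kk hL ν p.1) 2 (fun μ => liftEquiv (scShift d L mv kk hL μ) ι) hK0 hξS _ k μ p).trans hsW.le
  have hsub : ∀ k, mulOp (fun p : ScX d L mv kk hL × ι => scBump d L mv kk hL k p.1) ∘ₗ mulOp (fun p : ScX d L mv kk hL × ι => scChi d L mv kk hL k p.1) = mulOp (fun p : ScX d L mv kk hL × ι => scBump d L mv kk hL k p.1) :=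
    fun k => bcube_cut (2 * L) (fun ν (p : ScX d L mv kk hL × ι) => scXi d L mv kk hL ν p.1) 2 (fun μ => liftEquiv (scShift d L mv kk hL μ) ι) 0 (hwin2 0 k)
  have hχ : ∀ k, mulOp (fun p : ScX d L mv kk hL × ι => scChi d L mv kk hL k p.1) ∘ₗ mulOp (fun p : ScX d L mv kk hL × ι => scBump d L mv kk hL k p.1) = mulOp (fun p : ScX d L mv kk hL × ι => scBump d L mv kk hL k p.1) :=
    fun k => cut_bcube (2 * L) (fun ν (p : ScX d L mv kk hL × ι) => scXi d L mv kk hL ν p.1) 2 (fun μ => liftEquiv (scShift d L mv kk hL μ) ι) 0 (hwin2 0 k)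
  have hs : ∀ k μ, mulOp ((fun p : ScX d L mv kk hL × ι => scBump d L mv kk hL k p.1) ∘ (liftEquiv (scShift d L mv kk hL μ) ι)) ∘ₗ mulOp (fun p : ScX d L mv kk hL × ι => scChi d L mv kk hL k p.1) = mulOp ((fun p : ScX d L mv kk hL × ι => scBump d L mv kk hL k p.1) ∘ (liftEquiv (scShift d L mv kk hL μ) ι)) :=
    fun k μ => bcube_comp_shift_cut (2 * L) (fun ν (p : ScX d L mv kk hL × ι) => scXi d L mv kk hL ν p.1) 2 (fun μ => liftEquiv (scShift d L mv kk hL μ) ι) μ (hwin2 μ k)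
  have hsb : ∀ k μ, mulOp ((fun p : ScX d L mv kk hL × ι => scBump d L mv kk hL k p.1) ∘ (liftEquiv (scShift d L mv kk hL μ) ι).symm) ∘ₗ mulOp (fun p : ScX d L mv kk hL × ι => scChi d L mv kk hL k p.1) = mulOp ((fun p : ScX d L mv kk hL × ι => scBump d L mv kk hL k p.1) ∘ (liftEquiv (scShift d L mv kk hL μ) ι).symm) :=
    fun k μ => bcube_comp_shift_symm_cut (2 * L) (fun ν (p : ScX d L mv kk hL × ι) => scXi d L mv kk hL ν p.1) 2 (fun μ => liftEquiv (scShift d L mv kk hL μ) ι) μ (hwin2 μ k)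
  have hdd : ∀ k μ, mulOp (fgrad η⁻¹ (liftEquiv (scShift d L mv kk hL μ) ι) (fun p : ScX d L mv kk hL × ι => scBump d L mv kk hL k p.1)) ∘ₗ mulOp (fun p : ScX d L mv kk hL × ι => scChi d L mv kk hL k p.1) = mulOp (fgrad η⁻¹ (liftEquiv (scShift d L mv kk hL μ) ι) (fun p : ScX d L mv kk hL × ι => scBump d L mv kk hL k p.1)) :=
    fun k μ => fgrad_bcube_cut (2 * L) (fun ν (p : ScX d L mv kk hL × ι) => scXi d L mv kk hL ν p.1) 2 (fun μ => liftEquiv (scShift d L mv kk hL μ) ι) μ η⁻¹ (hwin2 μ k)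
  have hddb : ∀ k μ, mulOp (bgrad η⁻¹ (liftEquiv (scShift d L mv kk hL μ) ι) (fun p : ScX d L mv kk hL × ι => scBump d L mv kk hL k p.1)) ∘ₗ mulOp (fun p : ScX d L mv kk hL × ι => scChi d L mv kk hL k p.1) = mulOp (bgrad η⁻¹ (liftEquiv (scShift d L mv kk hL μ) ι) (fun p : ScX d L mv kk hL × ι => scBump d L mv kk hL k p.1)) :=
    fun k μ => bgrad_bcube_cut (2 * L) (fun ν (p : ScX d L mv kk hL × ι) => scXi d L mv kk hL ν p.1) 2 (fun μ => liftEquiv (scShift d L mv kk hL μ) ι) μ η⁻¹ (hwin2 μ k)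
  have hψχ : ∀ k, mulOp (fun p : ScX d L mv kk hL × ι => scPsi d L mv kk hL k p.1) ∘ₗ mulOp (fun p : ScX d L mv kk hL × ι => scChi d L mv kk hL k p.1) = mulOp (fun p : ScX d L mv kk hL × ι => scChi d L mv kk hL k p.1) :=
    fun k => mulOp_comp_mulOp_of_support_left fun p hp => chiCube_eq_one_of_inner_ne_zero hM hm₁ hfitI hS0 hp
  have hcut : ∀ k, HasMaj (ScNorm d L mv kk hL ι) (ScNorm d L mv kk hL ι) (mulOp (fun p : ScX d L mv kk hL × ι => scChi d L mv kk hL k p.1) ∘ₗ (mulOp (fun p : ScX d L mv kk hL × ι => scPsi d L mv kk hL k p.1) ∘ₗ scCube d L mv kk hL (aK a₀ (L : ℝ) kk * (((L ^ kk : ℕ) : ℝ)) ^ (d + 1)) ι k)) (fun y y' => ind (g := (unitTorusGeo L kk (cvM d L mv kk hL))) (cvSk d L mv kk hL k) y * ind (g := (unitTorusGeo L kk (cvM d L mv kk hL))) (cvSk d L mv kk hL k) y' * (β * Real.exp (-(δT * (unitTorusGeo L kk (cvM d L mv kk hL)).dist y y')))) :=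
    fun k => (hasMaj_cut_scCubeP ι hM hm₁ hfitI hm₂ hfit₂ hS0 hC.le hG0 k).mono (rateT _ hC.le)
  have hcutF : ∀ k μ, HasMaj (ScNorm d L mv kk hL ι) (ScNorm d L mv kk hL ι) (mulOp (fun p : ScX d L mv kk hL × ι => scChi d L mv kk hL k p.1) ∘ₗ (fgrad η⁻¹ (liftEquiv (scShift d L mv kk hL μ) ι) ∘ₗ (mulOp (fun p : ScX d L mv kk hL × ι => scPsi d L mv kk hL k p.1) ∘ₗ scCube d L mv kk hL (aK a₀ (L : ℝ) kk * (((L ^ kk : ℕ) : ℝ)) ^ (d + 1)) ι k))) (fun y y' => ind (g := (unitTorusGeo L kk (cvM d L mv kk hL))) (cvSk d L mv kk hL k) y * ind (g := (unitTorusGeo L kk (cvM d L mv kk hL))) (cvSk d L mv kk hL k) y' * (β₁ * Real.exp (-(δT * (unitTorusGeo L kk (cvM d L mv kk hL)).dist y y')))) :=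
    fun k μ => (hasMaj_cutF_scCubeP ι hM hm₁ hfitI hm₂ hfit₂ hS0 hC μ hGF k).mono (rateT _ hC.le)
  have hcutB : ∀ k μ, HasMaj (ScNorm d L mv kk hL ι) (ScNorm d L mv kk hL ι) (mulOp (fun p : ScX d L mv kk hL × ι => scChi d L mv kk hL k p.1) ∘ₗ (bgrad η⁻¹ (liftEquiv (scShift d L mv kk hL μ) ι) ∘ₗ (mulOp (fun p : ScX d L mv kk hL × ι => scPsi d L mv kk hL k p.1) ∘ₗ scCube d L mv kk hL (aK a₀ (L : ℝ) kk * (((L ^ kk : ℕ) : ℝ)) ^ (d + 1)) ι k))) (fun y y' => ind (g := (unitTorusGeo L kk (cvM d L mv kk hL))) (cvSk d L mv kk hL k) y * ind (g := (unitTorusGeo L kk (cvM d L mv kk hL))) (cvSk d L mv kk hL k) y' * (β₁ * Real.exp (-(δT * (unitTorusGeo L kk (cvM d L mv kk hL)).dist y y')))) :=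
    fun k μ => (hasMaj_cutB_scCubeP ι hM hm₁ hfitI hm₂ hfit₂ hS0 hC μ hGB k).mono (rateT _ hC.le)
  have hTf : ∀ k μ, (mulOp (fun p : ScX d L mv kk hL × ι => scPsi d L mv kk hL k p.1) ∘ₗ scCube d L mv kk hL (aK a₀ (L : ℝ) kk * (((L ^ kk : ℕ) : ℝ)) ^ (d + 1)) ι k) ∘ₗ fgrad η⁻¹ (liftEquiv (scShift d L mv kk hL μ) ι) ∘ₗ mulOp (fun p : ScX d L mv kk hL × ι => scChi d L mv kk hL k p.1) = (mulOp (fun p : ScX d L mv kk hL × ι => scPsi d L mv kk hL k p.1) ∘ₗ ((Matrix.mulVecLin (cGreen (cvM d L mv kk hL) (L ^ kk) (fun (_ : Fin (d + 1)) (_ : ScX d L mv kk hL) => (1 : Matrix ι ι ℝ)) (aK a₀ (L : ℝ) kk * (((L ^ kk : ℕ) : ℝ)) ^ (d + 1)))) ∘ₗ fgrad η⁻¹ (liftEquiv (scShift d L mv kk hL μ) ι)) ∘ₗ mulOp (fun p : ScX d L mv kk hL × ι => scPsi d L mv kk hL k p.1)) ∘ₗ mulOp (fun p : ScX d L mv kk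 hL × ι => scChi d L mv kk hL k p.1) :=
    fun k μ => scCubeP_fgrad_sandwich ι hM hm₂ hfit₂ hS0 _ _ μ k
  have hTb : ∀ k μ, (mulOp (fun p : ScX d L mv kk hL × ι => scPsi d L mv kk hL k p.1) ∘ₗ scCube d L mv kk hL (aK a₀ (L : ℝ) kk * (((L ^ kk : ℕ) : ℝ)) ^ (d + 1)) ι k) ∘ₗ bgrad η⁻¹ (liftEquiv (scShift d L mv kk hL μ) ι) ∘ₗ mulOp (fun p : ScX d L mv kk hL × ι => scChi d L mv kk hL k p.1) = (mulOp (fun p : ScX d L mv kk hL × ι => scPsi d L mv kk hL k p.1) ∘ₗ ((Matrix.mulVecLin (cGreen (cvM d L mv kk hL) (L ^ kk) (fun (_ : Fin (d + 1)) (_ : ScX d L mv kk hL) => (1 : Matrix ι ι ℝ)) (aK a₀ (L : ℝ) kk * (((L ^ kk : ℕ) : ℝ)) ^ (d + 1)))) ∘ₗ bgrad η⁻¹ (liftEquiv (scShift d L mv kk hL μ) ι)) ∘ₗ mulOp (fun p : ScX d L mv kk hL × ι => scPsi d L mv kk hL k p.1)) ∘ₗ mulOp (fun p : ScX d L mv kk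 hL × ι => scChi d L mv kk hL k p.1) :=
    fun k μ => scCubeP_bgrad_sandwich ι hM hm₂ hfit₂ hS0 _ _ μ k
  have hTfr : ∀ k μ, HasMaj (ScNorm d L mv kk hL ι) (ScNorm d L mv kk hL ι) ((mulOp (fun p : ScX d L mv kk hL × ι => scPsi d L mv kk hL k p.1) ∘ₗ ((Matrix.mulVecLin (cGreen (cvM d L mv kk hL) (L ^ kk) (fun (_ : Fin (d + 1)) (_ : ScX d L mv kk hL) => (1 : Matrix ι ι ℝ)) (aK a₀ (L : ℝ) kk * (((L ^ kk : ℕ) : ℝ)) ^ (d + 1)))) ∘ₗ fgrad η⁻¹ (liftEquiv (scShift d L mv kk hL μ) ι)) ∘ₗ mulOp (fun p : ScX d L mv kk hL × ι => scPsi d L mv kk hL k p.1))) (fun y y' => ind (g := (unitTorusGeo L kk (cvM d L mv kk hL))) (cvSk d L mv kk hL k) y * ind (g := (unitTorusGeo L kk (cvM d L mv kk hL))) (cvSk d L mv kk hL k) y' * (βQ * Real.exp (-(δT * (unitTorusGeo L kk (cvM d L mv kk hL)).dist y y')))) :=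
    fun k μ => by rw [hηinv]; exact hasMaj_scT ι hβQ0 (hGAf μ) k
  have hTbr : ∀ k μ, HasMaj (ScNorm d L mv kk hL ι) (ScNorm d L mv kk hL ι) ((mulOp (fun p : ScX d L mv kk hL × ι => scPsi d L mv kk hL k p.1) ∘ₗ ((Matrix.mulVecLin (cGreen (cvM d L mv kk hL) (L ^ kk) (fun (_ : Fin (d + 1)) (_ : ScX d L mv kk hL) => (1 : Matrix ι ι ℝ)) (aK a₀ (L : ℝ) kk * (((L ^ kk : ℕ) : ℝ)) ^ (d + 1)))) ∘ₗ bgrad η⁻¹ (liftEquiv (scShift d L mv kk hL μ) ι)) ∘ₗ mulOp (fun p : ScX d L mv kk hL × ι => scPsi d L mv kk hL k p.1))) (fun y y' => ind (g := (unitTorusGeo L kk (cvM d L mv kk hL))) (cvSk d L mv kk hL k) y * ind (g := (unitTorusGeo L kk (cvM d L mv kk hL))) (cvSk d L mv kk hL k) y' * (βQ * Real.exp (-(δT * (unitTorusGeo L kk (cvM d L mv kk hL)).dist y y')))) :=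
    fun k μ => by rw [hηinv]; exact hasMaj_scT ι hβQ0 (hGAb μ) k
  have hflat0 : ∀ k, (mulOp (fun p : ScX d L mv kk hL × ι => scBump d L mv kk hL k p.1) ∘ₗ (mulOp (fun p : ScX d L mv kk hL × ι => scPsi d L mv kk hL k p.1) ∘ₗ scCube d L mv kk hL (aK a₀ (L : ℝ) kk * (((L ^ kk : ℕ) : ℝ)) ^ (d + 1)) ι k)) ∘ₗ (lapOp η⁻¹ (fun μ => liftEquiv (scShift d L mv kk hL μ) ι) 0 + (scQQ d L mv kk hL (aK a₀ (L : ℝ) kk * (((L ^ kk : ℕ) : ℝ)) ^ (d + 1)) ι)) ∘ₗ mulOp (fun p : ScX d L mv kk hL × ι => scH d L mv kk hL k p.1) = mulOp (fun p : ScX d L mv kk hL × ι => scH d L mv kk hL k p.1) :=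
    fun k => by rw [hηinv]; exact scCubeP_flat_rightLocality ι hM hm₂ hfit₂ hS0 hw hfit ha' k (hhχ k)
  have hhcut : ∀ k, mulOp (fun p : ScX d L mv kk hL × ι => scH d L mv kk hL k p.1) ∘ₗ mulOp (fun p : ScX d L mv kk hL × ι => scChi d L mv kk hL k p.1) = mulOp (fun p : ScX d L mv kk hL × ι => scH d L mv kk hL k p.1) :=
    fun k => hcube_cut (2 * L) (fun ν (p : ScX d L mv kk hL × ι) => scXi d L mv kk hL ν p.1) (fun μ => liftEquiv (scShift d L mv kk hL μ) ι) 0 (hwin 0 k)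
  have hh1 : ∀ k μ x, |fgrad η⁻¹ (scShift d L mv kk hL μ) (scH d L mv kk hL k) x| ≤ (π / W) :=
    by rw [hηinv]; exact fun k μ x => (abs_fgrad_hcube_le (2 * L) (scXi d L mv kk hL) (scShift d L mv kk hL) hK0 hξ0 _ k μ x).trans hsW.le
  have hh1b : ∀ k μ x, |bgrad η⁻¹ (scShift d L mv kk hL μ) (scH d L mv kk hL k) x| ≤ (π / W) :=
    by rw [hηinv]; exact fun k μ x => (abs_bgrad_hcube_le (2 * L) (scXi d L mv kk hL) (scShift d L mv kk hL) hK0 hξ0 _ k μ x).trans hsW.le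
  have hh0 : ∀ k μ x, |scH d L mv kk hL k (scShift d L mv kk hL μ x) - scH d L mv kk hL k x| ≤ (π / W) := fun k μ x => abs_shift_sub_le_of_fgrad _ _ hη1 (hh1 k μ) x
  have hh2 : ∀ k μ p, |fgradAdj η⁻¹ (liftEquiv (scShift d L mv kk hL μ) ι) (fgrad η⁻¹ (liftEquiv (scShift d L mv kk hL μ) ι) (fun p : ScX d L mv kk hL × ι => scH d L mv kk hL k p.1)) p| ≤ (32 * π ^ 2 / W ^ 2) :=
    by rw [hηinv]; exact fun k μ p => (abs_fgradAdj_fgrad_hcube_le (2 * L) (fun ν (p : ScX d L mv kk hL × ι) => scXi d L mv kk hL ν p.1) (fun μ => liftEquiv (scShift d L mv kk hL μ) ι) hK2 hξS hs0 hs1 _ k μ p).trans hsW2.le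
  have hh2f : ∀ k μ p, |fgrad η⁻¹ (liftEquiv (scShift d L mv kk hL μ) ι) (fgrad η⁻¹ (liftEquiv (scShift d L mv kk hL μ) ι) (fun p : ScX d L mv kk hL × ι => scH d L mv kk hL k p.1)) p| ≤ (32 * π ^ 2 / W ^ 2) :=
    fun k μ p => abs_fgrad_fgrad_le_of _ _ (hh2 k μ) p
  have hh2b : ∀ k μ p, |bgrad η⁻¹ (liftEquiv (scShift d L mv kk hL μ) ι) (bgrad η⁻¹ (liftEquiv (scShift d L mv kk hL μ) ι) (fun p : ScX d L mv kk hL × ι => scH d L mv kk hL k p.1) ∘ ⇑(liftEquiv (scShift d L mv kk hL μ) ι)) p| ≤ (32 * π ^ 2 / W ^ 2) :=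
    fun k μ p => abs_bgrad_bgrad_shift_le_of _ _ (hh2 k μ) p
  have hlayf : ∀ k μ x, scH d L mv kk hL k x ≠ scH d L mv kk hL k ((scShift d L mv kk hL μ).symm x) → scChi d L mv kk hL k x = 1 :=
    fun k μ x h => coverH_layer_bwd hM hw hS6 k μ (x, 0) (by rwa [← scShift_symm_apply])
  have hlayb : ∀ k μ x, scH d L mv kk hL k (scShift d L mv kk hL μ x) ≠ scH d L mv kk hL k x → scChi d L mv kk hL k x = 1 := fun k μ x h => coverH_layer_fwd hM hw hS6 k μ (x, 0) h
  have hlayν : ∀ k x, scH d L mv kk hL k (scShift d L mv kk hL ν x) ≠ 0 → scChi d L mv kk hL k x = 1 := fun k x h => coverH_layer_shift hM hw hS6 k ν (x, 0) h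
  have hhψ : ∀ k, mulOp (fun p : ScX d L mv kk hL × ι => scH d L mv kk hL k p.1) ∘ₗ mulOp (fun p : ScX d L mv kk hL × ι => scPsi d L mv kk hL k p.1) = mulOp (fun p : ScX d L mv kk hL × ι => scH d L mv kk hL k p.1) :=
    fun k => mulOp_scH_comp_mulOp_scPsi ι hM hw hfit k
  have hχth : ∀ k, mulOp (fun p : ScX d L mv kk hL × ι => scBump d L mv kk hL k p.1) ∘ₗ mulOp (fun p : ScX d L mv kk hL × ι => scH d L mv kk hL k p.1) = mulOp (fun p : ScX d L mv kk hL × ι => scH d L mv kk hL k p.1) :=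
    fun k => mulOp_comp_mulOp_of_support_left fun p hp => bcube_eq_one_of_hcube_ne_zero_self (2 * L) (fun ν (p : ScX d L mv kk hL × ι) => scXi d L mv kk hL ν p.1) 2 (by norm_num) hp
  have hhts' : ∀ k μ, mulOp (fun p : ScX d L mv kk hL × ι => scBump d L mv kk hL k p.1) ∘ₗ mulOp ((fun p : ScX d L mv kk hL × ι => scH d L mv kk hL k p.1) ∘ (liftEquiv (scShift d L mv kk hL μ) ι)) = mulOp ((fun p : ScX d L mv kk hL × ι => scH d L mv kk hL k p.1) ∘ (liftEquiv (scShift d L mv kk hL μ) ι)) :=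
    fun k μ => mulOp_comp_mulOp_of_support_left fun p hp => bcube_eq_one_of_hcube_ne_zero (2 * L) (fun ν (p : ScX d L mv kk hL × ι) => scXi d L mv kk hL ν p.1) 2 (fun μ => liftEquiv (scShift d L mv kk hL μ) ι) hK0 hξS hR2 μ (x := (fun μ => liftEquiv (scShift d L mv kk hL μ) ι) μ p) (Or.inr (Or.inr (by simp))) hp
  have hhtsb' : ∀ k μ, mulOp (fun p : ScX d L mv kk hL × ι => scBump d L mv kk hL k p.1) ∘ₗ mulOp ((fun p : ScX d L mv kk hL × ι => scH d L mv kk hL k p.1) ∘ (liftEquiv (scShift d L mv kk hL μ) ι).symm) = mulOp ((fun p : ScX d L mv kk hL × ι => scH d L mv kk hL k p.1) ∘ (liftEquiv (scShift d L mv kk hL μ) ι).symm) :=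
    fun k μ => mulOp_comp_mulOp_of_support_left fun p hp => bcube_eq_one_of_hcube_ne_zero (2 * L) (fun ν (p : ScX d L mv kk hL × ι) => scXi d L mv kk hL ν p.1) 2 (fun μ => liftEquiv (scShift d L mv kk hL μ) ι) hK0 hξS hR2 μ (x := ((fun μ => liftEquiv (scShift d L mv kk hL μ) ι) μ).symm p) (Or.inr (Or.inl (by simp))) hp
  have hhtdd' : ∀ k μ, mulOp (fun p : ScX d L mv kk hL × ι => scBump d L mv kk hL k p.1) ∘ₗ mulOp (fgrad η⁻¹ (liftEquiv (scShift d L mv kk hL μ) ι) (fun p : ScX d L mv kk hL × ι => scH d L mv kk hL k p.1)) = mulOp (fgrad η⁻¹ (liftEquiv (scShift d L mv kk hL μ) ι) (fun p : ScX d L mv kk hL × ι => scH d L mv kk hL k p.1)) := fun k μ => mulOp_comp_mulOp_of_support_left fun p hp => by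
    by_cases h0 : scH d L mv kk hL k p.1 = 0
    · have h1 : scH d L mv kk hL k ((liftEquiv (scShift d L mv kk hL μ) ι) p).1 ≠ 0 := by
        intro h1; apply hp; rw [fgrad_apply]; simp only [h0, h1, sub_zero, mul_zero]
      exact bcube_eq_one_of_hcube_ne_zero (2 * L) (fun ν (p : ScX d L mv kk hL × ι) => scXi d L mv kk hL ν p.1) 2 (fun μ => liftEquiv (scShift d L mv kk hL μ) ι) hK0 hξS hR2 μ (x := (fun μ => liftEquiv (scShift d L mv kk hL μ) ι) μ p) (Or.inr (Or.inr (by simp))) h1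
    · exact bcube_eq_one_of_hcube_ne_zero_self (2 * L) (fun ν (p : ScX d L mv kk hL × ι) => scXi d L mv kk hL ν p.1) 2 (by norm_num) h0
  have hhtddb' : ∀ k μ, mulOp (fun p : ScX d L mv kk hL × ι => scBump d L mv kk hL k p.1) ∘ₗ mulOp (bgrad η⁻¹ (liftEquiv (scShift d L mv kk hL μ) ι) (fun p : ScX d L mv kk hL × ι => scH d L mv kk hL k p.1)) = mulOp (bgrad η⁻¹ (liftEquiv (scShift d L mv kk hL μ) ι) (fun p : ScX d L mv kk hL × ι => scH d L mv kk hL k p.1)) := fun k μ => mulOp_comp_mulOp_of_support_left fun p hp => by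
    by_cases h0 : scH d L mv kk hL k p.1 = 0
    · have h1 : scH d L mv kk hL k ((liftEquiv (scShift d L mv kk hL μ) ι).symm p).1 ≠ 0 := by
        intro h1; apply hp; rw [bgrad_apply]; simp only [h0, h1, sub_zero, mul_zero]
      exact bcube_eq_one_of_hcube_ne_zero (2 * L) (fun ν (p : ScX d L mv kk hL × ι) => scXi d L mv kk hL ν p.1) 2 (fun μ => liftEquiv (scShift d L mv kk hL μ) ι) hK0 hξS hR2 μ (x := ((fun μ => liftEquiv (scShift d L mv kk hL μ) ι) μ).symm p) (Or.inr (Or.inl (by simp))) h1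
    · exact bcube_eq_one_of_hcube_ne_zero_self (2 * L) (fun ν (p : ScX d L mv kk hL × ι) => scXi d L mv kk hL ν p.1) 2 (by norm_num) h0
  have hKN : ∀ k, HasMaj (ScNorm d L mv kk hL ι) (ScNorm d L mv kk hL ι) (commOp (scQQ d L mv kk hL (aK a₀ (L : ℝ) kk * (((L ^ kk : ℕ) : ℝ)) ^ (d + 1)) ι) (fun p : ScX d L mv kk hL × ι => scH d L mv kk hL k p.1)) (fun y y' => ((π * (d + 1) / W * 0 + 2 * (π * (d + 1) / W)) * a₀) * Real.exp (-((δm / 2) * (unitTorusGeo L kk (cvM d L mv kk hL)).dist y y'))) :=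
    fun k => (hasMaj_commOp_scQQ ι hM hw _ (δm / 2) k).mono fun y y' => mul_le_mul_of_nonneg_right hcNle (Real.exp_nonneg _)
  have hDAfη : ∀ k μ x, scChi d L mv kk hL k x ≠ 0 → ∀ i, ∑ j, |fgradMat η⁻¹ (scShift d L mv kk hL μ) ((tCoefA η (gaugePair (scShift d L mv kk hL) fun μ x => coordMat e (ContinuousLinearMap.mulLeftRight ℝ (Matrix mm mm ℂ) (u k x * U μ x * (u k (scShift d L mv kk hL μ x))ᴴ) (u k x * U μ x * (u k (scShift d L mv kk hL μ x))ᴴ)ᴴ))) (Sum.inl μ)) x i j| ≤ rD := by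
    rw [hηinv]; exact hDAf
  have hDAbη : ∀ k μ x, scChi d L mv kk hL k x ≠ 0 → ∀ i, ∑ j, |fgradMat η⁻¹ (scShift d L mv kk hL μ) ((tCoefA η (gaugePair (scShift d L mv kk hL) fun μ x => coordMat e (ContinuousLinearMap.mulLeftRight ℝ (Matrix mm mm ℂ) (u k x * U μ x * (u k (scShift d L mv kk hL μ x))ᴴ) (u k x * U μ x * (u k (scShift d L mv kk hL μ x))ᴴ)ᴴ))) (Sum.inr μ)) x i j| ≤ rD := by
    rw [hηinv]; exact hDAb
  have hEcovη : ∀ k, mmulOp (fun x => coordMat e (ContinuousLinearMap.mulLeftRight ℝ (Matrix mm mm ℂ) (u k x) (u k x)ᴴ)) ∘ₗ E ∘ₗ mmulOp (fun x => (coordMat e (ContinuousLinearMap.mulLeftRight ℝ (Matrix mm mm ℂ) (u k x) (u k x)ᴴ))ᵀ) = mmulOp (RE k) ∘ₗ bgrad η⁻¹ (liftEquiv (scShift d L mv kk hL ν) ι) + mmulOp (BE k) := by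
    rw [hηinv]; exact hEcov
  have hRE'η : ∀ k x, scChi d L mv kk hL k x ≠ 0 → ∀ i, ∑ j, |(fgradMat η⁻¹ (scShift d L mv kk hL ν) (RE k)) x i j| ≤ rR' := by
    rw [hηinv]; exact hRE'
  have key := uN_hasMaj_rightInverse_comp_localGauges_cov_loc (X := ScX d L mv kk hL) (ι := ι) (J := Fin (d + 1)) (K := Fin (d + 1) → ZMod (2 * L))
    (g := unitTorusGeo L kk (cvM d L mv kk hL)) (scBlk d L mv kk hL) (scShift d L mv kk hL) ν
    (N := fun k => mulOp (fun p : ScX d L mv kk hL × ι => scPsi d L mv kk hL k p.1) ∘ₗ scCube d L mv kk hL (aK a₀ (L : ℝ) kk * (((L ^ kk : ℕ) : ℝ)) ^ (d + 1)) ι k) (NL := scQQ d L mv kk hL (aK a₀ (L : ℝ) kk * (((L ^ kk : ℕ) : ℝ)) ^ (d + 1)) ι)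
    (χX := scChi d L mv kk hL) (χtX := scBump d L mv kk hL) (ψX := scPsi d L mv kk hL) (ψ₂X := scPsi d L mv kk hL)
    (hX := scH d L mv kk hL) (Sk := cvSk d L mv kk hL) (hb := coverHb (cvM d L mv kk hL) (L ^ kk) (L ^ mv) L)
    (Tf := fun k μ => (mulOp (fun p : ScX d L mv kk hL × ι => scPsi d L mv kk hL k p.1) ∘ₗ ((Matrix.mulVecLin (cGreen (cvM d L mv kk hL) (L ^ kk) (fun (_ : Fin (d + 1)) (_ : ScX d L mv kk hL) => (1 : Matrix ι ι ℝ)) (aK a₀ (L : ℝ) kk * (((L ^ kk : ℕ) : ℝ)) ^ (d + 1)))) ∘ₗ fgrad η⁻¹ (liftEquiv (scShift d L mv kk hL μ) ι)) ∘ₗ mulOp (fun p : ScX d L mv kk hL × ι => scPsi d L mv kk hL k p.1))) (Tb := fun k μ => (mulOp (fun p : ScX d L mv kk hL × ι => scPsi d L mv kk hL k p.1) ∘ₗ ((Matrix.mulVecLin (cGreen (cvM d L mv kk hL) (L ^ kk) (fun (_ : Fin (d + 1)) (_ : ScX d L mv kk hL) => (1 : Matrix ι ι ℝ)) (aK a₀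 (L : ℝ) kk * (((L ^ kk : ℕ) : ℝ)) ^ (d + 1)))) ∘ₗ bgrad η⁻¹ (liftEquiv (scShift d L mv kk hL μ) ι)) ∘ₗ mulOp (fun p : ScX d L mv kk hL × ι => scPsi d L mv kk hL k p.1)))
    e η (σ := δm / 32) (δ := δT) (ρ₁ := δm / 2) (ρ₂ := δm / 4) (ρ₃ := δm / 8) (ρN := δm / 2) (δV := δm) (ε := δm / 2) (ρF := δm) (cr := cr) (β := β) (β₁ := β₁) (βQ := βQ) (R := R) (Nov := Nov)
    (ct := π / W) (c₀ := π / W) (c₁ := π / W) (c₂ := 32 * π ^ 2 / W ^ 2) (ℓ := π * (d + 1) / W) (ω := π * (d + 1) / W) (cN := (π * (d + 1) / W * 0 + 2 * (π * (d + 1) / W)) * a₀)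
    (htri := triangle254_unitTorusGeo L kk _) (hd := unitTorusGeo_dist_nonneg L kk _) (hd0 := unitTorusGeo_dist_self L kk _) (hsymm := unitTorusGeo_dist_symm L kk _) (hrow := hrowS)
    (hσ := by positivity) (hβ := hC.le) (hβ₁ := hβ₁) (hβQ := hβQ0) (hct := div_nonneg pi_pos.le hWpos.le) (hR := hR0.le) (hcr := hcr0) (hNov := by positivity)
    (hc₀ := div_nonneg pi_pos.le hWpos.le) (hc₁ := div_nonneg pi_pos.le hWpos.le) (hc₂ := div_nonneg (by positivity) (pow_nonneg hWpos.le 2)) (hcN := by positivity)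
    (hℓ := div_nonneg (by positivity) hWpos.le) (hω := div_nonneg (by positivity) hWpos.le) (hε := by positivity) (hσρ := by linarith only [hδm0]) (hρ₁V := by linarith only [hδm0])
    (hρ₁G := by rw [hδTdef]; linarith only [hδm0]) (hρ₂ := by positivity) (hρ₂₁ := by linarith only [hδm0]) (hρ₃ := by positivity) (hρ₃₂ := by linarith only [hδm0])
    (hρ₃V := by linarith only [hδm0]) (hρ₃N := by linarith only [hδm0]) (hσρ₃ := by linarith only [hδm0]) (hSχ := hSχ) (hSψ := hSψ) (hSψ₂ := hSψ₂)
    (hχt := fun k x => abs_bcube_le_one (2 * L) (scXi d L mv kk hL) 2 k x) (hχ1 := fun k x => abs_chiCube_le_one _ _) (hdχt := hdχt) (hdχtb := hdχtb) (hsub := hsub) (hχ := hχ) (hs := hs)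
    (hsb := hsb) (hdd := hdd) (hddb := hddb) (hNψ := fun k => scCubeP_comp_mulOp_scPsi ι _ k) (hψχ := hψχ) (hcut := hcut) (hcutF := hcutF) (hcutB := hcutB) (hTf := hTf) (hTb := hTb) (hTfr := hTfr)
    (hTbr := hTbr) (hTfψ := fun k μ => scT_comp_mulOp_scPsi ι _ k) (hTbψ := fun k μ => scT_comp_mulOp_scPsi ι _ k) (hflat0 := hflat0)
    (hhabs := fun k x => abs_hcube_le_one (2 * L) (scXi d L mv kk hL) k x) (h236 := fun p => sum_hcube_sq (2 * L) (scXi d L mv kk hL) hK2 p.1) (hhcut := hhcut) (hh1 := hh1) (hh1b := hh1b)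
    (hh0 := hh0) (hLip := fun k y y' => abs_coverHb_sub_le hM hw k y y') (hrh := fun k x => abs_coverH_sub_coverHb_le hM hw k (x, 0)) (hh2 := hh2) (hh2f := hh2f) (hh2b := hh2b) (hlayf := hlayf)
    (hlayb := hlayb) (hlayν := hlayν) (hhψ := hhψ) (hχth := hχth) (hhts' := hhts') (hhtsb' := hhtsb') (hhtdd' := hhtdd') (hhtddb' := hhtddb')
    (hN := fun y => sum_ind_cubeBlocks_le (M := cvM d L mv kk hL) (w := L ^ mv) (q := L) (m₀ := coverMargin L mv) L kk y) (hKN := hKN) (he := he) (hu := hu) (hrV := hrV) (hrD := hrD) (hRN := hRN)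
    (hθF := hθF0) (hρF := by linarith only [hδm0]) (hRle := hRle) (hP := hP) (hCloc := hCloc) (hAloc := hAloc) (hDAf := hDAfη) (hDAb := hDAbη) (hNVcut := hNVcut) (hfarN := hfarN) (hrR := hrR)
    (hrR' := hrR') (hrB := hrB) (hleib := hleib) (hdh := hdh) (hEcov := hEcovη) (hRE := hRE) (hRE' := hRE'η) (hBE := hBE) (hqA := hsA) (hqL := hsmall.1) (hq := hq₀.trans_lt (by norm_num)) (hY := hY)
  refine key.mono fun y y' => le_of_le_of_eq (mul_le_mul_of_nonneg_right hsmall.2.2 (Real.exp_nonneg _)) ?_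
  rw [show δm / 8 - 2 * (δm / 32) = δm / 16 by ring, hB₀def, hB₁def, hB₂def, hX₂def, hP₂def]
  ring

end Knit

end Summit.QuantumFields.YangMills.BalabanUVNodes.N15.Gluing

end
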